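import Summits.Ventures.YMGap.Thresholds.RegionPoincare
import HarnessLib

/-!
# Venture YMGap — multi-link Bakry–Émery calculus, bridge:
# left-invariant frame gradients (`linkGradSq` of the tree's kernel-LSI fact) = the carré du champ `Γ`

HONEST FRAMING: venture file (cell `pub-ymgap`, track (a), seat p2); bookkeeping. The tree's named fact
`bakryEmery_kernelLogSobolev` (F₃) measures gradients by
`linkGradSq E f e M = ∑_α (d/dt f(M with M_e ↦ e^{tY_α} M_e)|₀)²` (LEFT perturbations in the Parseval
frame `Y_α` of `𝔰𝔲(N)`), while the multi-link Bakry–Émery files use the carré du champ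
`Γ(f,f) = ∑_{(e,α)} (D_{single_e Y_α} f)²` (RIGHT-invariant derivatives). At configurations with unitary
links the two agree link by link (`linkGradSq_eq_sum_algD_sq`): the left derivative along `Y` at `M_e`
is the right derivative along `M_eᴴ Y M_e`, `Ad_{M_eᴴ}` maps the Parseval frame to a Parseval frame, and
frame sums of squares of a linear functional do not depend on the Parseval frame (Riesz representer in
`𝔰𝔲(N)`, `Z_{λ∘Ad_{gᴴ}} = g Z_λ gᴴ`). Consequence: the uniform kernel Poincaré inequality of
`RegionPoincare.lean` in the `linkGradSq` currency of F₃ (`kernel_variance_le_linkGradSq`), i.e. the exact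
Poincaré analogue of `KernelLogSobolev` (for smooth `f`), hypothesis-free at `K = N/2 - N|β|Λ₀`.

## References

* Tree files `LatticeYangMillsUniformLogSobolev.lean` (`linkGradSq`), `SUNBakryEmeryFrame.lean`.
-/

noncomputable section

open scoped Matrix ComplexConjugate BigOperators Matrix.Norms.Frobenius ContDiff Topology ProbabilityTheory
open Matrix Complex Finset MeasureTheory Filter ProbabilityTheory NormedSpace
open Literature.MathematicalPhysics.QuantumFieldTheory
open Literature.MathematicalPhysics.QuantumLattice (fundamentalRep LGConfig ymSpecification)
open Literature.MathematicalPhysics.QuantumFieldTheory.SUNBakryEmery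
  (FrameIdx frame frame_conjTranspose frame_trace frameGrad frameGrad_conjTranspose frameGrad_trace
   apply_eq_neg_re_trace_mul_frameGrad frobNorm_frameGrad_sq frobNorm_sq_of_skew SUN)

namespace Summit.Ventures.YMGap

namespace LatticeBakryEmery

universe u

variable {ι : Type u} [Fintype ι] [DecidableEq ι] {N : ℕ}

/-! ### Frame sums of squares are `Ad`-invariant -/

/-- **Uniqueness of the Riesz representer in `𝔰𝔲(N)`**: if `Re tr(X A) = Re tr(X B)` for all
`X ∈ 𝔰𝔲(N)` and `A, B ∈ 𝔰𝔲(N)`, then `A = B`. -/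
theorem eq_of_re_trace_mul_eq {A B : Matrix (Fin N) (Fin N) ℂ} (hA : Aᴴ = -A) (hB : Bᴴ = -B)
    (hA0 : A.trace = 0) (hB0 : B.trace = 0)
    (h : ∀ X : Matrix (Fin N) (Fin N) ℂ, Xᴴ = -X → X.trace = 0 → (X * A).trace.re = (X * B).trace.re) :
    A = B := by
  have hW : (A - B)ᴴ = -(A - B) := by rw [conjTranspose_sub, hA, hB, neg_sub_neg, neg_sub]
  have hW0 : (A - B).trace = 0 := by rw [trace_sub, hA0, hB0, sub_zero]
  have h1 := h (A - B) hW hW0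
  have h2 : ((A - B) * (A - B)).trace.re = 0 := by
    rw [Matrix.mul_sub, trace_sub, Complex.sub_re, h1, sub_self]
  have h3 : frobNorm (A - B) ^ 2 = 0 := by rw [frobNorm_sq_of_skew hW, h2, neg_zero]
  have h4 : frobNorm (A - B) = 0 := by simpa using h3
  rw [frobNorm_eq_norm, norm_eq_zero] at h4
  exact sub_eq_zero.1 h4

/-- **`Ad`-invariance of frame sums of squares**: for a real linear functional `λ` on `M_N(ℂ)` and a
unitary `g`, `∑_α λ(gᴴ Y_α g)² = ∑_α λ(Y_α)²` (both are squared Hilbert–Schmidt norms of Riesz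
representers in `𝔰𝔲(N)`, and `Z_{λ∘Ad_{gᴴ}} = g Z_λ gᴴ`). -/
theorem sum_sq_apply_conj_frame (hN : N ≠ 0) (lam : Matrix (Fin N) (Fin N) ℂ →ₗ[ℝ] ℝ)
    {g : Matrix (Fin N) (Fin N) ℂ} (hg : g ∈ Matrix.unitaryGroup (Fin N) ℂ) :
    ∑ α : FrameIdx N, lam (gᴴ * frame α * g) ^ 2 = ∑ α : FrameIdx N, lam (frame α) ^ 2 := by
  have hgg : gᴴ * g = 1 := Unitary.star_mul_self_of_mem hg
  have hgg' : g * gᴴ = 1 := Unitary.mul_star_self_of_mem hg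
  -- the conjugated functional `λ'(A) = λ(gᴴ A g)`
  set lam' : Matrix (Fin N) (Fin N) ℂ →ₗ[ℝ] ℝ :=
    lam.comp ((LinearMap.mulLeft ℝ gᴴ).comp (LinearMap.mulRight ℝ g)) with hlam'
  have hlam'_apply : ∀ A, lam' A = lam (gᴴ * A * g) := fun A => by
    simp [hlam', Matrix.mul_assoc]
  have hsum : ∑ α : FrameIdx N, lam (gᴴ * frame α * g) ^ 2 = ∑ α : FrameIdx N, lam' (frame α) ^ 2 :=
    sum_congr rfl fun α _ => by rw [hlam'_apply]
  rw [hsum, ← frobNorm_frameGrad_sq hN lam', ← frobNorm_frameGrad_sq hN lam]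
  set Z := frameGrad lam with hZ
  set Z' := frameGrad lam' with hZ'
  have hZs : Zᴴ = -Z := frameGrad_conjTranspose lam
  have hZ0 : Z.trace = 0 := frameGrad_trace hN lam
  have hZ's : Z'ᴴ = -Z' := frameGrad_conjTranspose lam'
  have hZ'0 : Z'.trace = 0 := frameGrad_trace hN lam'
  have hcs : (g * Z * gᴴ)ᴴ = -(g * Z * gᴴ) := by
    rw [conjTranspose_mul, conjTranspose_mul, conjTranspose_conjTranspose, hZs]
    simp [Matrix.mul_assoc]
  have hc0 : (g * Z * gᴴ).trace = 0 := by
    rw [Matrix.mul_assoc, trace_mul_comm, Matrix.mul_assoc, hgg, Matrix.mul_one, hZ0]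
  -- `Z' = g Z gᴴ` by uniqueness of the representer
  have hrep : Z' = g * Z * gᴴ := by
    refine eq_of_re_trace_mul_eq hZ's hcs hZ'0 hc0 fun X hX hX0 => ?_
    have e1 : lam' X = -(X * Z').trace.re := apply_eq_neg_re_trace_mul_frameGrad hN lam' hX hX0
    have hXc : (gᴴ * X * g)ᴴ = -(gᴴ * X * g) := by
      rw [conjTranspose_mul, conjTranspose_mul, conjTranspose_conjTranspose, hX]
      simp [Matrix.mul_assoc]
    have hXc0 : (gᴴ * X * g).trace = 0 := by
      rw [Matrix.mul_assoc, trace_mul_comm, Matrix.mul_assoc, hgg', Matrix.mul_one, hX0]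
    have e2 : lam (gᴴ * X * g) = -(gᴴ * X * g * Z).trace.re := apply_eq_neg_re_trace_mul_frameGrad hN lam hXc hXc0
    have e4 : (gᴴ * X * g * Z).trace = (X * (g * Z * gᴴ)).trace := by
      rw [show gᴴ * X * g * Z = gᴴ * (X * g * Z) by simp only [Matrix.mul_assoc], trace_mul_comm]
      simp only [Matrix.mul_assoc]
    have : -(X * Z').trace.re = -(X * (g * Z * gᴴ)).trace.re := by rw [← e1, hlam'_apply, e2, e4]
    linarith
  rw [hrep, frobNorm_conj_unitary hg Z]

/-! ### Left frame derivatives versus right-invariant derivatives -/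

/-- `g · exp(gᴴ A g) = exp(A) · g` for unitary `g` (conjugation of the exponential). -/
theorem mul_exp_conj_unitary {g : Matrix (Fin N) (Fin N) ℂ} (hg : g ∈ Matrix.unitaryGroup (Fin N) ℂ)
    (A : Matrix (Fin N) (Fin N) ℂ) : g * NormedSpace.exp (gᴴ * A * g) = NormedSpace.exp A * g := by
  have hgg : gᴴ * g = 1 := Unitary.star_mul_self_of_mem hg
  have hgg' : g * gᴴ = 1 := Unitary.mul_star_self_of_mem hg
  have hunit : IsUnit gᴴ := ⟨⟨gᴴ, g, hgg, hgg'⟩, rfl⟩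
  have hinv : (gᴴ)⁻¹ = g := Matrix.inv_eq_right_inv hgg
  have h := Matrix.exp_conj gᴴ A hunit
  rw [hinv] at h
  rw [h, ← Matrix.mul_assoc, ← Matrix.mul_assoc, hgg', Matrix.one_mul]

omit [Fintype ι] in
/-- The left-perturbation curve in the link `e` is a right flow with the conjugated direction:
`update Q e (exp(tY) Q_e) = Q · exp(t · single_e (Q_eᴴ Y Q_e))` for unitary `Q_e`. -/
theorem update_exp_mul_eq [Fintype ι] (Q : Cfg ι N) (e : ι) (hQe : Q e ∈ Matrix.unitaryGroup (Fin N) ℂ)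
    (Y : Matrix (Fin N) (Fin N) ℂ) (t : ℝ) :
    Function.update Q e (NormedSpace.exp (t • Y) * Q e) = Q * NormedSpace.exp (t • lk e ((Q e)ᴴ * Y * Q e)) := by
  rw [exp_smul_lk]
  funext i
  by_cases h : i = e
  · subst h
    rw [Function.update_self, Pi.mul_apply, Pi.mulSingle_eq_same,
      show t • ((Q i)ᴴ * Y * Q i) = (Q i)ᴴ * (t • Y) * Q i by rw [Matrix.mul_smul, Matrix.smul_mul],
      mul_exp_conj_unitary hQe]
  · rw [Function.update_of_ne h, Pi.mul_apply, Pi.mulSingle_eq_of_ne h, mul_one]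

/-- **Left frame derivative = right-invariant derivative with conjugated direction**:
`d/dt f(update Q e (e^{tY} Q_e))|₀ = D_{single_e (Q_eᴴ Y Q_e)} f (Q)` for smooth `f` and unitary `Q_e`. -/
theorem deriv_update_exp_mul {f : Cfg ι N → ℝ} (hf : ContDiff ℝ ∞ f) (Q : Cfg ι N) (e : ι)
    (hQe : Q e ∈ Matrix.unitaryGroup (Fin N) ℂ) (Y : Matrix (Fin N) (Fin N) ℂ) :
    deriv (fun t : ℝ => f (Function.update Q e (NormedSpace.exp (t • Y) * Q e))) 0 =
      algD (lk e ((Q e)ᴴ * Y * Q e)) f Q := by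
  have hfun : (fun t : ℝ => f (Function.update Q e (NormedSpace.exp (t • Y) * Q e))) =
      fun t => f (Q * NormedSpace.exp (t • lk e ((Q e)ᴴ * Y * Q e))) := by
    funext t; rw [update_exp_mul_eq Q e hQe Y t]
  rw [hfun]
  have h := (hasDerivAt_comp_mul_exp hf Q (lk e ((Q e)ᴴ * Y * Q e)) 0).deriv
  rw [zero_smul, NormedSpace.exp_zero, mul_one] at h
  exact h

/-- **`linkGradSq` is the link-`e` part of `Γ`** at configurations with unitary links:
`∑_α (d/dt f(update M e (e^{tY_α} M_e))|₀)² = ∑_α (D_{single_e Y_α} f (M))²` (frame independence). -/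
theorem sum_sq_deriv_update_eq (hN : N ≠ 0) {f : Cfg ι N → ℝ} (hf : ContDiff ℝ ∞ f) (M : Cfg ι N) (e : ι)
    (hMe : M e ∈ Matrix.unitaryGroup (Fin N) ℂ) :
    ∑ α : FrameIdx N, (deriv (fun t : ℝ => f (Function.update M e (NormedSpace.exp (t • frame α) * M e))) 0) ^ 2 =
      ∑ α : FrameIdx N, algD (lk e (frame α)) f M ^ 2 := by
  simp_rw [deriv_update_exp_mul hf M e hMe]
  have h := sum_sq_apply_conj_frame hN (linkFun f M e) hMe
  simp only [linkFun_apply] at h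
  exact h

/-- **`Γ(f,f)` as the sum of the tree's `linkGradSq` over the links** at `SU(N)^E` configurations. -/
theorem Gam_eq_sum_linkGradSq {d : ℕ} (hN : N ≠ 0) (E : Finset (Literature.MathematicalPhysics.QuantumFieldTheory.ZdEdge d))
    {f : Cfg ↥E N → ℝ} (hf : ContDiff ℝ ∞ f) (g : PSU ↥E N) :
    Gam f f (emb g) = ∑ e : ↥E, linkGradSq E f e (emb g) := by
  rw [Gam_self_eq_sum_linkFun]
  refine sum_congr rfl fun e _ => ?_
  unfold linkGradSq
  rw [sum_sq_deriv_update_eq hN hf (emb g) e (emb_mem_unitaryGroup g e)]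
  rfl

/-- **Uniform kernel Poincaré inequality in the `linkGradSq` currency of the tree's kernel-LSI fact**
(the Poincaré analogue of `KernelLogSobolev`, for smooth `f`): for every finite region `E`, boundary
condition `η`, regional Hessian constant `Λ₀` and `K = N/2 - N|β|Λ₀ > 0`,
`Var_{γ_E(·|η)}(F) ≤ (1/K) ∑_{e∈E} ∫ linkGradSq E f e dγ_E(·|η)`, `F = f((U_e)_{e∈E})`. Kernel theorem, no named fact. -/
theorem kernel_variance_le_linkGradSq {d : ℕ} {Λ₀ : ℝ} (hH : RegionWilsonHessianBound d N Λ₀) (hN : N ≠ 0) (β : ℝ)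
    (hK : 0 < (N : ℝ) / 2 - N * |β| * Λ₀)
    (E : Finset (Literature.MathematicalPhysics.QuantumFieldTheory.ZdEdge d)) (η : LGConfig d (SUN N))
    {f : Cfg ↥E N → ℝ} (hf : ContDiff ℝ ∞ f) :
    Var[matrixCylinder E f; ymSpecification (fundamentalRep (Fin N)) ((N : ℝ) * β) E η] ≤
      1 / ((N : ℝ) / 2 - N * |β| * Λ₀) *
        ∑ e : ↥E, ∫ U, linkGradSq E f e (fun e' => (U e' : Matrix (Fin N) (Fin N) ℂ))
          ∂(ymSpecification (fundamentalRep (Fin N)) ((N : ℝ) * β) E η) := by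
  have h := kernel_variance_le_integral_Gam hH hN β hK E η hf
  refine h.trans (le_of_eq ?_)
  congr 1
  have hpt : ∀ U : LGConfig d (SUN N), matrixCylinder E (Gam f f) U =
      ∑ e : ↥E, linkGradSq E f e (fun e' => (U e' : Matrix (Fin N) (Fin N) ℂ)) := by
    intro U
    exact Gam_eq_sum_linkGradSq hN E hf (fun e : ↥E => U e)
  simp_rw [hpt]
  rw [integral_finsetSum]
  intro e _
  -- each summand is continuous, hence integrable for the (finite) kernel measure
  have hc : Continuous fun U : LGConfig d (SUN N) => linkGradSq E f e (fun e' => (U e' : Matrix (Fin N) (Fin N) ℂ)) := by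
    have h1 : ∀ U : LGConfig d (SUN N), linkGradSq E f e (fun e' => (U e' : Matrix (Fin N) (Fin N) ℂ)) =
        ∑ α : FrameIdx N, algD (lk e (frame α)) f (emb (fun e' : ↥E => U e')) ^ 2 := by
      intro U
      unfold linkGradSq
      rw [show (fun e' : ↥E => (U e' : Matrix (Fin N) (Fin N) ℂ)) = emb (fun e' : ↥E => U e') from rfl,
        sum_sq_deriv_update_eq hN hf _ e (emb_mem_unitaryGroup _ e)]
    simp_rw [h1]
    refine continuous_finsetSum _ fun α _ => ?_
    refine ((contDiff_algD hf _).continuous.comp ?_).pow 2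
    exact continuous_emb.comp (continuous_pi fun e' => continuous_apply _)
  haveI : IsFiniteMeasure (ymSpecification (fundamentalRep (Fin N)) ((N : ℝ) * β) E η) := by
    unfold ymSpecification; infer_instance
  exact hc.integrable_of_hasCompactSupport (HasCompactSupport.of_compactSpace _)

end LatticeBakryEmery

end Summit.Ventures.YMGap
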